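import Mathlib

/-!
# SECANT-A, endpoint lemmas (census-1 g22, STAGING) — search for candidate a priori estimates; no regularity claim

The exact-rational post-processing of leg (C) replaces the true values `F = Φ v`, `G = Φ (v - τ•Δv)`,
`H = Φ (v + τ•Δv)` by certified interval ENDPOINTS. These lemmas close that last formal gap:
with `0 < Flo ≤ F ≤ Fhi`, `G ≤ Ghi`, `H ≤ Hhi`:

* `bwd_quotient_le_Ucert` : `(G - F)/(τ F) ≤ (Ghi - Flo)/(τ Flo)`          (U_cert of `harvest_secant.py`)
* `Lcert_le_fwd_quotient` : `(Flo - Hhi)/(τ Fhi) ≤ (F - H)/(τ F)`          (L_cert of `harvest_secant.py`)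
* `rate_le_Ucert` : any `D ≤ (G - F)/τ` (the kernel bound `SecantA.heatDissipation_le_bwd_secant`) has
  `D / F ≤ (Ghi - Flo)/(τ Flo)`; `Lcert_le_rate` dually from `(F - H)/τ ≤ D`.
Pure real arithmetic (`import Mathlib` only), so it can sit next to `SecantDissipation.STAGING.lean` unchanged.
-/

namespace Summit.NavierStokesRegularity.FunctionalMining.SecantA.Endpoints

/-- `U_cert`: with `0 < Flo ≤ F` and `G ≤ Ghi`, `0 ≤ Ghi`, the backward quotient `(G − F)/(τF)` is at most
`(Ghi − Flo)/(τ Flo)`. [ours; elementary] -/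
theorem bwd_quotient_le_Ucert {F Flo G Ghi τ : ℝ} (hτ : 0 < τ) (hFlo : 0 < Flo) (hF : Flo ≤ F)
    (hG : G ≤ Ghi) (hGhi : 0 ≤ Ghi) :
    (G - F) / (τ * F) ≤ (Ghi - Flo) / (τ * Flo) := by
  have hFpos : 0 < F := lt_of_lt_of_le hFlo hF
  rw [div_le_div_iff₀ (by positivity) (by positivity)]
  -- (G - F) * (τ * Flo) ≤ (Ghi - Flo) * (τ * F)  ⟸  G*Flo ≤ Ghi*F
  have h1 : G * Flo ≤ Ghi * Flo := mul_le_mul_of_nonneg_right hG hFlo.le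
  have h2 : Ghi * Flo ≤ Ghi * F := mul_le_mul_of_nonneg_left hF hGhi
  nlinarith [mul_pos hτ hFlo, mul_pos hτ hFpos]

/-- `L_cert`: with `0 < Flo ≤ F ≤ Fhi` and `H ≤ Hhi`, `(Flo − Hhi)/(τ Fhi) ≤ (F − H)/(τ F)`. [ours; elementary] -/
theorem Lcert_le_fwd_quotient {F Flo Fhi H Hhi τ : ℝ} (hτ : 0 < τ) (hFlo : 0 < Flo) (hF : Flo ≤ F)
    (hF' : F ≤ Fhi) (hH : H ≤ Hhi) (hHhi : 0 ≤ Hhi) (hnum : 0 ≤ Flo - Hhi) :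
    (Flo - Hhi) / (τ * Fhi) ≤ (F - H) / (τ * F) := by
  have hFpos : 0 < F := lt_of_lt_of_le hFlo hF
  have hFhi : 0 < Fhi := lt_of_lt_of_le hFpos hF'
  rw [div_le_div_iff₀ (by positivity) (by positivity)]
  -- (Flo - Hhi) * (τ * F) ≤ (F - H) * (τ * Fhi)
  have h1 : (Flo - Hhi) * F ≤ (Flo - Hhi) * Fhi := mul_le_mul_of_nonneg_left hF' hnum
  have h2 : H * Fhi ≤ Hhi * Fhi := mul_le_mul_of_nonneg_right hH hFhi.le
  have h3 : Hhi * Flo ≤ Hhi * Fhi := mul_le_mul_of_nonneg_left (le_trans hF hF') hHhi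
  nlinarith [mul_pos hτ hFpos, mul_pos hτ hFhi, mul_le_mul_of_nonneg_left hF hHhi]

/-- Combination with an abstract dissipation value `D` bounded by the backward secant (the kernel's
`heatDissipation_le_bwd_secant` gives exactly `D ≤ (G - F)/τ`). -/
theorem rate_le_Ucert {D F Flo G Ghi τ : ℝ} (hτ : 0 < τ) (hFlo : 0 < Flo) (hF : Flo ≤ F)
    (hG : G ≤ Ghi) (hGhi : 0 ≤ Ghi) (hD : D ≤ (G - F) / τ) :
    D / F ≤ (Ghi - Flo) / (τ * Flo) := by
  have hFpos : 0 < F := lt_of_lt_of_le hFlo hF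
  have : D / F ≤ (G - F) / (τ * F) := by
    rw [show (G - F) / (τ * F) = ((G - F) / τ) / F by field_simp]
    exact div_le_div_of_nonneg_right hD hFpos.le
  exact this.trans (bwd_quotient_le_Ucert hτ hFlo hF hG hGhi)

/-- Dually, any `D` with `(F − H)/τ ≤ D` has `(Flo − Hhi)/(τ Fhi) ≤ D/F`. [ours; elementary] -/
theorem Lcert_le_rate {D F Flo Fhi H Hhi τ : ℝ} (hτ : 0 < τ) (hFlo : 0 < Flo) (hF : Flo ≤ F)
    (hF' : F ≤ Fhi) (hH : H ≤ Hhi) (hHhi : 0 ≤ Hhi) (hnum : 0 ≤ Flo - Hhi) (hD : (F - H) / τ ≤ D) :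
    (Flo - Hhi) / (τ * Fhi) ≤ D / F := by
  have hFpos : 0 < F := lt_of_lt_of_le hFlo hF
  have : (F - H) / (τ * F) ≤ D / F := by
    rw [show (F - H) / (τ * F) = ((F - H) / τ) / F by field_simp]
    exact div_le_div_of_nonneg_right hD hFpos.le
  exact (Lcert_le_fwd_quotient hτ hFlo hF hF' hH hHhi hnum).trans this

/-- A coercivity rate refuted by endpoints: if `c ≤ (G - F)/(τ F)` for the true values (kernel:
`HeatCoercive.rate_le_bwd_secant_quotient`) then `c ≤ U_cert`. -/
theorem rate_le_Ucert' {c F Flo G Ghi τ : ℝ} (hτ : 0 < τ) (hFlo : 0 < Flo) (hF : Flo ≤ F)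
    (hG : G ≤ Ghi) (hGhi : 0 ≤ Ghi) (hc : c ≤ (G - F) / (τ * F)) :
    c ≤ (Ghi - Flo) / (τ * Flo) :=
  hc.trans (bwd_quotient_le_Ucert hτ hFlo hF hG hGhi)

end Summit.NavierStokesRegularity.FunctionalMining.SecantA.Endpoints
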